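import Summits.QuantumFields.YangMills.Theorems.FluctuationComparisonRegPrIntLS2BetaTwoLegFilling
import Summits.QuantumFields.YangMills.Theorems.FluctuationComparisonRegPrIntLS2BetaBlockOffsetCoordinates
import HarnessLib

/-!
# S2β · D-GUARD ∕ (BG∞) — STAGE I ON A BLOCK ((L-I) of UV3-NODE §116 ADDENDUM 1, binder style per desk RULING №127): px5 g24's index-free two-leg filling ✓p839248, read
# through the OFFSET COORDINATES of a closed block (✓`…BlockOffsetCoordinates`), is a section of the block with the prescribed data on the two `α`-faces, axial steps
# `≤ max(π∕ℓ₁, π∕ℓ₂)`, transverse steps `≤ ((π−r)∕sin r)·(face-data step)` and the position invariant — the stage of classes 100 ∕ 010 ∕ 001 of the 8-colour gluing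

Cell `ym3-torus` (YM ladder rung R3 = continuum `SU(2)` Yang–Mills on the three-torus at fixed lattice data — a RUNG: NOT d = 4, NOT infinite volume,
NOT a mass gap, NOT Clay).  Width seat «width 19» `ym3-torus-px19` (gen 25, ★p1 lineage), FREE px helper on crux `stmt-QuantumFields-20520`
(`FluctuationComparisonRegPrIntL`; registry `Lines/semiclassical_s2beta.lean` UNTOUCHED, 0∕5); `--kind proof --supports stmt-QuantumFields-20520 --as helper`,
count-neutral, DEFINITION-FREE (0 `def`, 0 `instance`, 0 `notation`, 0 `sorry`, default heartbeats; the filling `W` is PINNED by the displayed hypothesis `hW`).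

WHY.  In the descent formulation (UV3-NODE §116 ADD.1) a stage-1 block `Q` (odd axis `α`) carries the section `w_Q(x) := fill(φ⁻(π⁻x), φ⁺(π⁺x), m_Q, ℓ₁, ℓ₂; k)` with
`k = (x_α − start(Q_α)).val` — ✓p839248's `fill` indexed by the face site and the `α`-offset.  Reading `x` through its offset vector `t(x)` (✓`eq_natCast_add_offset`), the
filling is an OFFSET-indexed function `W t := fill(φ₀(t|_{α↦0}), φ₁(t|_{α↦0}), m, ℓ₁, ℓ₂; t_α)`, and a bond inside the block is ONE unit step of ONE offset
(✓`read_tgt_eq`).  So ✓`dist1_fill_succ_le` IS the axial bond bound, ✓`dist1_fill_transverse_le` IS the transverse bond bound (with the face data read at the two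
face-adjacent offset vectors), ✓`fill_zero`∕`fill_end` ARE the face agreements ((DESC₁) of ADD.1), and ✓`norm_logVec_mid_inv_fill_le` IS the position invariant.

WHAT IS PROVED (sorry-free; `P`, `j`, `N := P.sitesPerDir j`; corner `s : Fin P.d → ℕ`; offsets `t(x) κ := (x κ − (s κ : ZMod N)).val`; `W` pinned by `hW`).
* §1 `update_offsetZero_of_eq_zero` ∕ `update_update_succ_zero` ∕ `update_update_ne_zero` — the offset-vector algebra of faces and steps.
* §2 ★ `stageI_face_zero` (`t(x)_α = 0 ⟹ W (t x) = φ₀ (t x)`), ★ `stageI_face_end` (`t(x)_α = ℓ₁ + ℓ₂ ⟹ W (t x) = φ₁ ((t x)|_{α↦0})`).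
* §3 ★★★ `dist1_stageI_axial_le` — a bond in direction `α` inside the block: `dist1 (W (t src)·(W (t tgt))⁻¹) ≤ max (π∕ℓ₁) (π∕ℓ₂)`;
  ★★★ `dist1_stageI_transverse_le` — a bond in direction `μ ≠ α`, data `(π − r)`-inside the chart at `m`: `≤ ((π−r)∕sin r)·max (dist1 (φ₀ z·(φ₀ z′)⁻¹)) (dist1 (φ₁ z·(φ₁ z′)⁻¹))`
  with `z := (t src)|_{α↦0}`, `z′ := update z μ (z μ + 1)` — the two face-adjacent offset vectors.
* §4 ★★ `norm_logVec_mid_inv_stageI_le` — `‖logVec (m⁻¹·W (t x))‖ ≤ max ‖logVec (m⁻¹ φ₀ z)‖ ‖logVec (m⁻¹ φ₁ z)‖` for `t(x)_α ≤ ℓ₁ + ℓ₂`.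

HONEST SCOPE.  Composition of landed sphere geometry (✓p839248) with offset bookkeeping (✓`…BlockOffsetCoordinates`); no gauge field; nothing of Bałaban's renormalisation-group
analysis is asserted or proved ([Balaban1985RegularSpaces] Lemma 1 p.79, (1.36) p.82, Thm 2 p.83 — local small gauges).  (BG∞) ∕ `hsupp⁺` is a CONJECTURE (plan §116) and is
NOT proved; (L-T)(L-S)(L-Σ) are OPEN; GAP♯∘ (`stub_uniformFibreGapOrbit`, registry UNTOUCHED), the five registered stubs (0∕5), S2β, 20520, 19936, 19200, `YM3TorusSU2` are
NOT proved; no registered stub is closed; rung R3 — NOT d = 4, NOT infinite volume, NOT a mass gap, NOT Clay; the Yang–Mills mass gap is NOT proved.  Axioms standard.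

References: T. Bałaban, CMP **99** (1985) 75–102 [Balaban1985RegularSpaces] (Lemma 1 p.79, (1.36) p.82, Thm 2 p.83).
-/

set_option autoImplicit false

noncomputable section

namespace Summit.QuantumFields.YangMills.Theorems.FluctuationComparisonRegPrIntLS2BetaSqrtGaugeStageIBlock

open scoped Real
open Literature.MathematicalPhysics.QuantumLattice (su2Quat)
open Literature.MathematicalPhysics.QuantumFieldTheory.Balaban1983to89
open T4CubeChartGnomonic (SU2)
open T4HaarSU2ExpChart (expPoint)
open T4ExpWindowSmallField (logVec)
open Summit.QuantumFields.YangMills.Theorems.FluctuationComparisonRegPrIntLS2BetaTwoLegFilling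
  (fill_zero fill_end dist1_fill_succ_le dist1_fill_transverse_le norm_logVec_mid_inv_fill_le)
open Summit.QuantumFields.YangMills.Theorems.FluctuationComparisonRegPrIntLS2BetaBlockOffsetCoordinates (read_tgt_eq)

variable {P : Params} {j : ℕ}

/-! ## §1 Offset-vector algebra of faces and steps -/

/-- On the face `t_α = 0` the face projection is the identity: `update t α 0 = t`. [folklore] -/
theorem update_offsetZero_of_eq_zero {d : ℕ} (t : Fin d → ℕ) (α : Fin d) (h : t α = 0) : Function.update t α 0 = t := by
  rw [← h, Function.update_eq_self]

/-- A step in direction `α` does not move the face projection: `update (update t α v) α 0 = update t α 0`. [folklore] -/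
theorem update_update_succ_zero {d : ℕ} (t : Fin d → ℕ) (α : Fin d) (v : ℕ) :
    Function.update (Function.update t α v) α 0 = Function.update t α 0 :=
  Function.update_idem _ _ _

/-- A step in direction `μ ≠ α` commutes with the face projection. [folklore] -/
theorem update_update_ne_zero {d : ℕ} (t : Fin d → ℕ) {α μ : Fin d} (h : μ ≠ α) (v : ℕ) :
    Function.update (Function.update t μ v) α 0 = Function.update (Function.update t α 0) μ v :=
  Function.update_comm h _ _ _

section StageI

variable (φ₀ φ₁ : (Fin P.d → ℕ) → SU2) (m : SU2) (α : Fin P.d) (ℓ₁ ℓ₂ : ℕ) (W : (Fin P.d → ℕ) → SU2)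
  (hW : ∀ t : Fin P.d → ℕ, W t =
    if t α ≤ ℓ₁ then φ₀ (Function.update t α 0) * expPoint ((((t α : ℕ) : ℝ) / ℓ₁) • logVec (su2Quat ((φ₀ (Function.update t α 0))⁻¹ * m)))
    else m * expPoint ((((t α - ℓ₁ : ℕ) : ℝ) / ℓ₂) • logVec (su2Quat (m⁻¹ * φ₁ (Function.update t α 0)))))
  (s : Fin P.d → ℕ)

/-! ## §2 The prescribed faces -/

include hW in
/-- ★ **FACE `t_α = 0`**: the section is the first face datum. [folklore] -/
theorem stageI_face_zero (x : Site P j) (h0 : (x α - ((s α : ℕ) : ZMod (P.sitesPerDir j))).val = 0) :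
    W (fun κ => (x κ - ((s κ : ℕ) : ZMod (P.sitesPerDir j))).val) = φ₀ (fun κ => (x κ - ((s κ : ℕ) : ZMod (P.sitesPerDir j))).val) := by
  set t : Fin P.d → ℕ := fun κ => (x κ - ((s κ : ℕ) : ZMod (P.sitesPerDir j))).val with ht
  have htα : t α = 0 := h0
  have h := fill_zero φ₀ φ₁ m ℓ₁ ℓ₂ (Function.update t α 0)
  rw [hW t, update_offsetZero_of_eq_zero t α htα] at *
  rw [htα]
  exact h

include hW in
/-- ★ **FACE `t_α = ℓ₁ + ℓ₂`**: the section is the second face datum read at the face-0 projection (`0 < ℓ₂`). [folklore] -/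
theorem stageI_face_end (hℓ₂ : 0 < ℓ₂) (x : Site P j) (h1 : (x α - ((s α : ℕ) : ZMod (P.sitesPerDir j))).val = ℓ₁ + ℓ₂) :
    W (fun κ => (x κ - ((s κ : ℕ) : ZMod (P.sitesPerDir j))).val) =
      φ₁ (Function.update (fun κ => (x κ - ((s κ : ℕ) : ZMod (P.sitesPerDir j))).val) α 0) := by
  set t : Fin P.d → ℕ := fun κ => (x κ - ((s κ : ℕ) : ZMod (P.sitesPerDir j))).val with ht
  have htα : t α = ℓ₁ + ℓ₂ := h1
  have h := fill_end φ₀ φ₁ m ℓ₁ hℓ₂ (Function.update t α 0)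
  rw [hW t, htα]
  exact h

/-! ## §3 The bond steps -/

include hW in
/-- ★★★ **THE AXIAL BOND STEP**: along a bond in direction `α` inside the block (source `α`-offset `+ 1 < N`), the section moves by `≤ max (π∕ℓ₁) (π∕ℓ₂)`.
[cite: Balaban1985RegularSpaces, (1.36) p.82] -/
theorem dist1_stageI_axial_le (hℓ₁ : 0 < ℓ₁) (hℓ₂ : 0 < ℓ₂) (b : PBond P j) (hdir : b.dir = α)
    (hN : (b.src b.dir - ((s b.dir : ℕ) : ZMod (P.sitesPerDir j))).val + 1 < P.sitesPerDir j) :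
    dist1 (W (fun κ => (b.src κ - ((s κ : ℕ) : ZMod (P.sitesPerDir j))).val) *
      (W (fun κ => (b.tgt κ - ((s κ : ℕ) : ZMod (P.sitesPerDir j))).val))⁻¹) ≤ max (π / ℓ₁) (π / ℓ₂) := by
  rw [read_tgt_eq W s b hN]
  subst hdir
  set t : Fin P.d → ℕ := fun κ => (b.src κ - ((s κ : ℕ) : ZMod (P.sitesPerDir j))).val with ht
  have h := dist1_fill_succ_le φ₀ φ₁ m hℓ₁ hℓ₂ (Function.update t b.dir 0) (t b.dir)
  rw [hW t, hW (Function.update t b.dir (t b.dir + 1)), Function.update_self, update_update_succ_zero]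
  exact h

include hW in
/-- ★★★ **THE TRANSVERSE BOND STEP**: along a bond in direction `μ ≠ α` inside the block, with both face data `(π − r)`-inside the chart at `m` and the `α`-offset
`≤ ℓ₁ + ℓ₂`, the section moves by `≤ ((π − r)∕sin r)·max (dist1 (φ₀ z·(φ₀ z′)⁻¹)) (dist1 (φ₁ z·(φ₁ z′)⁻¹))`, where `z := (offsets of the source)|_{α↦0}` and
`z′ := update z μ (z μ + 1)` are the two face-adjacent offset vectors (✓`dist1_fill_transverse_le`). [cite: Balaban1985RegularSpaces, Thm 2 p.83] -/
theorem dist1_stageI_transverse_le {r : ℝ} (hr : 0 < r) (hrπ : r < π)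
    (h₀ : ∀ u, ‖logVec (su2Quat (m⁻¹ * φ₀ u))‖ ≤ π - r) (h₁ : ∀ u, ‖logVec (su2Quat (m⁻¹ * φ₁ u))‖ ≤ π - r)
    (hℓ₁ : 0 < ℓ₁) (hℓ₂ : 0 < ℓ₂) (b : PBond P j) (hdir : b.dir ≠ α)
    (hk : (b.src α - ((s α : ℕ) : ZMod (P.sitesPerDir j))).val ≤ ℓ₁ + ℓ₂)
    (hN : (b.src b.dir - ((s b.dir : ℕ) : ZMod (P.sitesPerDir j))).val + 1 < P.sitesPerDir j) :
    dist1 (W (fun κ => (b.src κ - ((s κ : ℕ) : ZMod (P.sitesPerDir j))).val) *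
      (W (fun κ => (b.tgt κ - ((s κ : ℕ) : ZMod (P.sitesPerDir j))).val))⁻¹) ≤
      (π - r) / Real.sin r *
        max (dist1 (φ₀ (Function.update (fun κ => (b.src κ - ((s κ : ℕ) : ZMod (P.sitesPerDir j))).val) α 0) *
              (φ₀ (Function.update (Function.update (fun κ => (b.src κ - ((s κ : ℕ) : ZMod (P.sitesPerDir j))).val) α 0) b.dir
                ((b.src b.dir - ((s b.dir : ℕ) : ZMod (P.sitesPerDir j))).val + 1)))⁻¹))
            (dist1 (φ₁ (Function.update (fun κ => (b.src κ - ((s κ : ℕ) : ZMod (P.sitesPerDir j))).val) α 0) *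
              (φ₁ (Function.update (Function.update (fun κ => (b.src κ - ((s κ : ℕ) : ZMod (P.sitesPerDir j))).val) α 0) b.dir
                ((b.src b.dir - ((s b.dir : ℕ) : ZMod (P.sitesPerDir j))).val + 1)))⁻¹)) := by
  rw [read_tgt_eq W s b hN]
  set t : Fin P.d → ℕ := fun κ => (b.src κ - ((s κ : ℕ) : ZMod (P.sitesPerDir j))).val with ht
  have hk' : t α ≤ ℓ₁ + ℓ₂ := hk
  have h := dist1_fill_transverse_le φ₀ φ₁ m hr hrπ h₀ h₁ hℓ₁ hℓ₂ (Function.update t α 0)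
    (Function.update (Function.update t α 0) b.dir (t b.dir + 1)) hk'
  have hα : Function.update t b.dir (t b.dir + 1) α = t α := Function.update_of_ne (Ne.symm hdir) _ _
  have hzμ : (Function.update t α 0) b.dir = t b.dir := Function.update_of_ne hdir _ _
  rw [hW t, hW (Function.update t b.dir (t b.dir + 1)), hα, update_update_ne_zero t hdir]
  exact h

/-! ## §4 The position invariant -/

include hW in
/-- ★★ **THE SECTION STAYS IN THE DATA's BALL ABOUT `m`** (the «no cut locus» letter passed to the tube∕sphere stages): for `t(x)_α ≤ ℓ₁ + ℓ₂` and data off the cut locus of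
`m`, `‖logVec (m⁻¹·W (t x))‖ ≤ max ‖logVec (m⁻¹ φ₀ z)‖ ‖logVec (m⁻¹ φ₁ z)‖`, `z := (t x)|_{α↦0}` (✓`norm_logVec_mid_inv_fill_le`). [folklore] -/
theorem norm_logVec_mid_inv_stageI_le (h₀ : ∀ u, ‖logVec (su2Quat (m⁻¹ * φ₀ u))‖ < π) (hℓ₁ : 0 < ℓ₁) (hℓ₂ : 0 < ℓ₂) (x : Site P j)
    (hk : (x α - ((s α : ℕ) : ZMod (P.sitesPerDir j))).val ≤ ℓ₁ + ℓ₂) :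
    ‖logVec (su2Quat (m⁻¹ * W (fun κ => (x κ - ((s κ : ℕ) : ZMod (P.sitesPerDir j))).val)))‖ ≤
      max ‖logVec (su2Quat (m⁻¹ * φ₀ (Function.update (fun κ => (x κ - ((s κ : ℕ) : ZMod (P.sitesPerDir j))).val) α 0)))‖
          ‖logVec (su2Quat (m⁻¹ * φ₁ (Function.update (fun κ => (x κ - ((s κ : ℕ) : ZMod (P.sitesPerDir j))).val) α 0)))‖ := by
  set t : Fin P.d → ℕ := fun κ => (x κ - ((s κ : ℕ) : ZMod (P.sitesPerDir j))).val with ht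
  have hk' : t α ≤ ℓ₁ + ℓ₂ := hk
  have h := norm_logVec_mid_inv_fill_le φ₀ φ₁ m h₀ hℓ₁ hℓ₂ (Function.update t α 0) hk'
  rw [hW t]
  exact h

end StageI

end Summit.QuantumFields.YangMills.Theorems.FluctuationComparisonRegPrIntLS2BetaSqrtGaugeStageIBlock

end
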